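import Summits.QuantumFields.BalabanUV.Beta.EriceRemainderEnclosureHistoryAutonomyComparisonAgeCompositionThreeAgesTotalLoad

/-!
# EriceRemainderEnclosureHistoryAutonomyComparisonAgeCompositionTwoAgesOldRead — (E91a) route (N), first order: THE OLD READ IS A SLOWLY VARYING WINDOW
# AVERAGE.  Along every box solution of an isotone dominated memory with floor and for every damping of the SELF-CONSISTENT class `g_t·(1 + F_t) ≥ 1`
# (`F_t = Σ_j L_j h_{t+j}³∕2` the lag-zero weight; (E75a): `g = 1∕(1+f)`, `0 ≤ f ≤ F`): the lag-zero weight is SMALL AT DEPTH, `F_t ≤ 1 − a_t∕a_{t+1} ≤ 1∕(t+1)`,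
# hence dampings are weak, `g_t ≥ (t+1)∕(t+2)`, damping products telescope, `Π_{[s,s+d)} g ≥ (s+1)∕(s+d+1)`, the old coefficient PERSISTS across `d`
# pins, `(k+d)³·c_k(m+d)·Π g ≥ k³·c_k(m)`, and the damped read of an old age `k` moves by at most `4d·c_k(m)·e_m` over `d ≤ k` pins whenever
# `0 ≤ ε ≤ e` holds beyond the pin — the estimate that lets (E91b) `…TwoAgesFar` prove the two-age END at EVERY ratio, beyond total load one

Cell `pub-balaban`, β-function sub-cell, BINDER row D4 «RemainderConst leaves for Bałaban's split» (`HOME/BINDER-OWNERS.md`; owner lineage `b2b-balaban-beta-an4`;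
this file by co-owner #2 lineage `b2b-balaban-beta-d4-p2`, generation 82), β-FLOW TEAM duty (1), FREEZE (0) honoured (def-free; nothing restated).

HONEST FRAMING (page 1, verbatim and binding).  *"Discharging BetaPertH makes Bałaban's UV stability UNCONDITIONAL — a real constructive-QFT result; it is
NOT the continuum limit and NOT the Clay problem."*  THIS FILE DISCHARGES NOTHING OF THE KIND.  Elementary real algebra ∕ real analysis about ABSTRACT
functionals on a box ]0,γ]^ℕ with displayed floors, profiles and signs, and the FIRST-ORDER renewal objects of route (N) built from them — hypotheses of a
census, not facts; the form, signs, ages and moments of Bałaban's (1.22) limit functional are NOT PRINTED ([I] p. 298; GAPS G-t4-U2-1∕-2) and NOT asserted.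
Row D4 class UNCHANGED (critical-path width 0; instance 0∕1; D4 DISCHARGE NO DATE).  HONEST DEPENDENCY: continuum YM on T⁴ ⇐ BetaPertH ∧ nine spine
estimates (0/9 proved); BetaPertH ⇐ (D1) ∧ (D4) ∧ CAP+tail; G-an2-4 gates asym, D1 and NE2/3/4.

THE POINT (README `HOME/b2b-balaban-beta-d4-p2/g82/e91/README.md` §2).  The read of an old age `k` at the pin `m` is `c_k(m)·Σ_{q∈(m,m+k]} (Π_{[q,m+k]} g)·ε_q`
with `c_k(m) = L_k h_{m+k}³∕2 = x_k(m)∕k`; one pin later, `d` targets have entered (cost `≤ d·c_k(m)·e_m`) and on the common targets the coefficient has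
dropped from `c_k(m)` to `c_k(m+d)·Π_{(m+k, m+k+d]} g` — by at most the factor `(k∕(k+d))³ ≥ 1 − 3d∕(k+d)`: the LEVEL part `(k∕(k+d))²` is concavity of
`1∕h²` from the pin `0` ((E90b) `mul_sq_le_from_pin`), the DAMPING part `k∕(k+d)` is the telescoping product of `g_t ≥ (t+1)∕(t+2)`, itself from the
lag-zero weight bound `F_t ≤ 1∕(t+1)` (domination at ONE step: `h_{t+j}³ ≤ 2h_{t+1}²h_{t+j+1}`, `Σ_j L_j h_{t+1+j} ≤ a_{t+1} − a_t`, and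
`1 − a_t∕a_{t+1} ≤ 1∕(t+1)` by (E90b) `mul_invSq_le_from_pin`).  So the old read varies by `≤ 4d·c_k(m)·e_m = 4(d∕k)·x_k(m)·e_m` — `O(1∕k)` per pin:
a WINDOW AVERAGE.  (With an ARBITRARY damping in `]0,1]` this fails — one killed scale just beyond `m+k` blinds the next pins; numerics `g82/numerics/ren3.py`.)
Uses (E90b) `mul_sq_le_from_pin`∕`mul_invSq_le_from_pin`, (E79) `strictAnti_of_memFlow` BY NAME.  NOT CLAIMED: anything printed — NOT B12 Thm 2, NOT BetaPertH.

WHAT IS PROVED ([folklore]; 0 `def`, 0 sorry).  `le_two_mul_succ`, **`lagZero_le`** (`F_t ≤ 1∕(t+1)`), **`damping_ge`** (`g_t ≥ (t+1)∕(t+2)`), `damping_prod_ge`,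
**`old_coeff_persist`**, `old_read_eq`, **`old_read_variation`**.
-/
noncomputable section
open Finset

namespace Summit.QuantumFields.BalabanUV.Beta.EriceRemainderEnclosureHistoryAutonomyComparisonAgeCompositionTwoAgesOldRead

open Literature.MathematicalPhysics.QuantumFieldTheory.Balaban1983to89
open Literature.MathematicalPhysics.QuantumFieldTheory.Balaban1983to89.T4BetaStationary
open Literature.MathematicalPhysics.QuantumFieldTheory.Balaban1983to89.T4BetaFlowWellPosed
open Summit.QuantumFields.BalabanUV.Beta.EriceRemainderEnclosureHistoryAutonomyOrder (strictAnti_of_memFlow)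
open Summit.QuantumFields.BalabanUV.Beta.EriceRemainderEnclosureHistoryAutonomyComparisonAgeCompositionWindowShares
  (mul_invSq_le_from_pin mul_sq_le_from_pin)

variable {B : (ℕ → ℝ) → ℝ} {γ b gIR : ℝ} {L : ℕ → ℝ} {K : ℕ} {h g : ℕ → ℝ}

/-! ## §1 The lag-zero weight and the dampings of the self-consistent class -/

/-- Levels at most double in one scale from scale one on: `h(s) ≤ 2·h(s+1)` for `s ≥ 1` (concavity of `1∕h²` from the pin `0`). [folklore] -/
theorem le_two_mul_succ (hmono : ∀ u v : ℕ → ℝ, SeqBox γ u → SeqBox γ v → (∀ j, u j ≤ v j) → B u ≤ B v) (hb : 0 < b)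
    (hlo : ∀ u, SeqBox γ u → b ≤ B u) (hh : SeqBox γ h) (hf : MemFlow B gIR h) {s : ℕ} (hs : 1 ≤ s) : h s ≤ 2 * h (s + 1) := by
  have hpos : ∀ n, 0 < h n := fun n => (hh n).1
  have key := mul_sq_le_from_pin hmono hb hlo hh hf 0 s 1
  simp only [Nat.zero_add, Nat.cast_one] at key
  have hs' : (1 : ℝ) ≤ s := by exact_mod_cast hs
  have h1 := hpos s
  have h2 := hpos (s + 1)
  have hsq : h s ^ 2 ≤ (2 * h (s + 1)) ^ 2 := by nlinarith [sq_nonneg (h (s + 1)), sq_nonneg (h s)]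
  exact le_of_pow_le_pow_left₀ two_ne_zero (by positivity) hsq

/-- **THE LAG-ZERO WEIGHT**: `F_t = Σ_{j<K} L_j h_{t+j}³∕2 ≤ 1∕(t+1)` along every flow (no age `0`): `h_{t+j}³ ≤ 2h_{t+1}²h_{t+j+1}`, domination at the
step `t`, and `1 − a_t∕a_{t+1} ≤ 1∕(t+1)` by concavity. [folklore] -/
theorem lagZero_le (hmono : ∀ u v : ℕ → ℝ, SeqBox γ u → SeqBox γ v → (∀ j, u j ≤ v j) → B u ≤ B v) (hL : ∀ k, 0 ≤ L k) (hb : 0 < b)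
    (hlo : ∀ u, SeqBox γ u → b ≤ B u) (hdom : ∀ u, SeqBox γ u → ∑ k ∈ range K, L k * u k ≤ B u) (hh : SeqBox γ h) (hf : MemFlow B gIR h)
    (hL0 : L 0 = 0) (t : ℕ) : ∑ k ∈ range K, L k * h (t + k) ^ 3 / 2 ≤ 1 / ((t : ℝ) + 1) := by
  have hpos : ∀ n, 0 < h n := fun n => (hh n).1
  have hanti := (strictAnti_of_memFlow hb hlo hh hf).antitone
  have hterm : ∀ k ∈ range K, L k * h (t + k) ^ 3 / 2 ≤ h (t + 1) ^ 2 * (L k * h (t + 1 + k)) := by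
    intro k _
    rcases Nat.eq_zero_or_pos k with rfl | hk
    · rw [hL0]; simp
    · have h2 : h (t + k) ≤ 2 * h (t + k + 1) := le_two_mul_succ hmono hb hlo hh hf (by omega)
      have hmn : h (t + k) ≤ h (t + 1) := hanti (by omega)
      have hp1 := hpos (t + k)
      have hp2 := hpos (t + 1)
      have hp3 := hpos (t + k + 1)
      have hLk := hL k
      rw [show t + 1 + k = t + k + 1 by ring]
      have hc : h (t + k) ^ 3 ≤ h (t + 1) ^ 2 * (2 * h (t + k + 1)) := by
        calc h (t + k) ^ 3 = h (t + k) ^ 2 * h (t + k) := by ring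
          _ ≤ h (t + 1) ^ 2 * (2 * h (t + k + 1)) :=
              mul_le_mul (pow_le_pow_left₀ hp1.le hmn 2) h2 hp1.le (sq_nonneg _)
      nlinarith [mul_le_mul_of_nonneg_left hc hLk]
  have hstep : ∑ k ∈ range K, L k * h (t + 1 + k) ≤ 1 / h (t + 1) ^ 2 - 1 / h t ^ 2 := by
    have := hdom _ (seqBox_shift hh (t + 1))
    have e := hf.2 t
    linarith
  have hrise : 1 / h (t + 1) ^ 2 - 1 / h t ^ 2 ≤ (1 / ((t : ℝ) + 1)) * (1 / h (t + 1) ^ 2) := by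
    have key := mul_invSq_le_from_pin hmono hb hlo hh hf 0 t 1
    simp only [Nat.zero_add, Nat.cast_one] at key
    have ht : (0 : ℝ) ≤ t := Nat.cast_nonneg t
    have ha1 : 0 < 1 / h (t + 1) ^ 2 := by have := hpos (t + 1); positivity
    have ha0 : 0 < 1 / h t ^ 2 := by have := hpos t; positivity
    rw [div_mul_eq_mul_div, one_mul, le_div_iff₀ (by linarith)]
    nlinarith
  calc ∑ k ∈ range K, L k * h (t + k) ^ 3 / 2 ≤ ∑ k ∈ range K, h (t + 1) ^ 2 * (L k * h (t + 1 + k)) := sum_le_sum hterm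
    _ = h (t + 1) ^ 2 * ∑ k ∈ range K, L k * h (t + 1 + k) := by rw [mul_sum]
    _ ≤ h (t + 1) ^ 2 * ((1 / ((t : ℝ) + 1)) * (1 / h (t + 1) ^ 2)) :=
        mul_le_mul_of_nonneg_left (hstep.trans hrise) (sq_nonneg _)
    _ = 1 / ((t : ℝ) + 1) := by have := hpos (t + 1); field_simp

/-- **DAMPINGS OF THE SELF-CONSISTENT CLASS ARE WEAK**: `g_t·(1 + F_t) ≥ 1` and `F_t ≤ 1∕(t+1)` give `g_t ≥ (t+1)∕(t+2)`. [folklore] -/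
theorem damping_ge (hmono : ∀ u v : ℕ → ℝ, SeqBox γ u → SeqBox γ v → (∀ j, u j ≤ v j) → B u ≤ B v) (hL : ∀ k, 0 ≤ L k) (hb : 0 < b)
    (hlo : ∀ u, SeqBox γ u → b ≤ B u) (hdom : ∀ u, SeqBox γ u → ∑ k ∈ range K, L k * u k ≤ B u) (hh : SeqBox γ h) (hf : MemFlow B gIR h)
    (hL0 : L 0 = 0) (hg : ∀ t, 0 < g t ∧ g t ≤ 1) (hgF : ∀ t, 1 ≤ g t * (1 + ∑ k ∈ range K, L k * h (t + k) ^ 3 / 2)) (t : ℕ) :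
    ((t : ℝ) + 1) / ((t : ℝ) + 2) ≤ g t := by
  have hF := lagZero_le hmono hL hb hlo hdom hh hf hL0 t
  have hF0 : 0 ≤ ∑ k ∈ range K, L k * h (t + k) ^ 3 / 2 :=
    sum_nonneg fun k _ => by have := hL k; have := (hh (t + k)).1; positivity
  have ht : (0 : ℝ) ≤ t := Nat.cast_nonneg t
  have hg0 := (hg t).1
  have h1 := hgF t
  -- 1 ≤ g (1 + F) ≤ g (1 + 1∕(t+1)) = g (t+2)∕(t+1)
  have h2 : 1 ≤ g t * (1 + 1 / ((t : ℝ) + 1)) := h1.trans (mul_le_mul_of_nonneg_left (by linarith) hg0.le)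
  rw [div_le_iff₀ (by linarith)]
  have e : g t * (1 + 1 / ((t : ℝ) + 1)) * ((t : ℝ) + 1) = g t * ((t : ℝ) + 2) := by field_simp; ring
  nlinarith [mul_le_mul_of_nonneg_right h2 (show (0 : ℝ) ≤ (t : ℝ) + 1 by linarith)]

/-- … hence damping products persist: `Π_{t ∈ [s, s+d)} g_t ≥ (s+1)∕(s+d+1)` (telescoping). [folklore] -/
theorem damping_prod_ge (hmono : ∀ u v : ℕ → ℝ, SeqBox γ u → SeqBox γ v → (∀ j, u j ≤ v j) → B u ≤ B v) (hL : ∀ k, 0 ≤ L k) (hb : 0 < b)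
    (hlo : ∀ u, SeqBox γ u → b ≤ B u) (hdom : ∀ u, SeqBox γ u → ∑ k ∈ range K, L k * u k ≤ B u) (hh : SeqBox γ h) (hf : MemFlow B gIR h)
    (hL0 : L 0 = 0) (hg : ∀ t, 0 < g t ∧ g t ≤ 1) (hgF : ∀ t, 1 ≤ g t * (1 + ∑ k ∈ range K, L k * h (t + k) ^ 3 / 2)) (s d : ℕ) :
    ((s : ℝ) + 1) / ((s : ℝ) + d + 1) ≤ ∏ t ∈ Ico s (s + d), g t := by
  induction d with
  | zero => simp only [Nat.cast_zero, add_zero, Ico_self, prod_empty]; exact div_self_le_one _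
  | succ d ih =>
    rw [show s + (d + 1) = s + d + 1 by ring, prod_Ico_succ_top (by omega)]
    have hgt := damping_ge hmono hL hb hlo hdom hh hf hL0 hg hgF (s + d)
    have hs : (0 : ℝ) ≤ s := Nat.cast_nonneg s
    have hd : (0 : ℝ) ≤ d := Nat.cast_nonneg d
    have hP0 : 0 ≤ ∏ t ∈ Ico s (s + d), g t := prod_nonneg fun t _ => (hg t).1.le
    push_cast at hgt ⊢
    have hfrac : ((s : ℝ) + 1) / ((s : ℝ) + (d + 1) + 1) = ((s : ℝ) + 1) / ((s : ℝ) + d + 1) * (((s : ℝ) + d + 1) / ((s : ℝ) + d + 2)) := by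
      field_simp; ring
    rw [hfrac]
    have hq0 : 0 ≤ ((s : ℝ) + 1) / ((s : ℝ) + d + 1) := by positivity
    calc ((s : ℝ) + 1) / ((s : ℝ) + d + 1) * (((s : ℝ) + d + 1) / ((s : ℝ) + d + 2))
        ≤ (∏ t ∈ Ico s (s + d), g t) * (((s : ℝ) + d + 1) / ((s : ℝ) + d + 2)) := mul_le_mul_of_nonneg_right ih (by positivity)
      _ ≤ (∏ t ∈ Ico s (s + d), g t) * g (s + d) := by
          exact mul_le_mul_of_nonneg_left hgt hP0

/-! ## §2 Persistence of the old coefficient; the old read varies slowly -/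

/-- **PERSISTENCE OF THE OLD COEFFICIENT ACROSS THE YOUNG WINDOW**: `(k+d)³·c_k(m+d)·Π_{t∈[m+k+1, m+k+d+1)} g_t ≥ k³·c_k(m)` — level persistence
`(k+d)·h_{m+k+d}² ≥ k·h_{m+k}²` (concavity from the pin `0`) and damping persistence `Π g ≥ (m+k+2)∕(m+k+d+2) ≥ k∕(k+d)`. [folklore] -/
theorem old_coeff_persist (hmono : ∀ u v : ℕ → ℝ, SeqBox γ u → SeqBox γ v → (∀ j, u j ≤ v j) → B u ≤ B v) (hL : ∀ k, 0 ≤ L k) (hb : 0 < b)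
    (hlo : ∀ u, SeqBox γ u → b ≤ B u) (hdom : ∀ u, SeqBox γ u → ∑ k ∈ range K, L k * u k ≤ B u) (hh : SeqBox γ h) (hf : MemFlow B gIR h)
    (hL0 : L 0 = 0) (hg : ∀ t, 0 < g t ∧ g t ≤ 1) (hgF : ∀ t, 1 ≤ g t * (1 + ∑ k ∈ range K, L k * h (t + k) ^ 3 / 2)) {k : ℕ} (hk : 1 ≤ k)
    (m d : ℕ) :
    (k : ℝ) ^ 3 * (L k * h (m + k) ^ 3 / 2)
      ≤ ((k : ℝ) + d) ^ 3 * (L k * h (m + d + k) ^ 3 / 2) * ∏ t ∈ Ico (m + k + 1) (m + k + 1 + d), g t := by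
  have hpos : ∀ n, 0 < h n := fun n => (hh n).1
  have hanti := (strictAnti_of_memFlow hb hlo hh hf).antitone
  have hkr : (1 : ℝ) ≤ k := by exact_mod_cast hk
  have hd : (0 : ℝ) ≤ d := Nat.cast_nonneg d
  have hm : (0 : ℝ) ≤ m := Nat.cast_nonneg m
  have h1 := hpos (m + k)
  have h2 := hpos (m + d + k)
  -- level persistence from the pin 0: (m+k) h_{m+k}² ≤ (m+k+d) h_{m+k+d}²
  have hlev := mul_sq_le_from_pin hmono hb hlo hh hf 0 (m + k) d
  simp only [Nat.zero_add, Nat.cast_add] at hlev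
  rw [show m + k + d = m + d + k by ring] at hlev
  have hle : h (m + d + k) ≤ h (m + k) := hanti (by omega)
  have hsq : (k : ℝ) * h (m + k) ^ 2 ≤ ((k : ℝ) + d) * h (m + d + k) ^ 2 := by
    nlinarith [mul_le_mul_of_nonneg_left (pow_le_pow_left₀ h2.le hle 2) hm]
  have hlin : (k : ℝ) * h (m + k) ≤ ((k : ℝ) + d) * h (m + d + k) := by
    have : ((k : ℝ) * h (m + k)) ^ 2 ≤ (((k : ℝ) + d) * h (m + d + k)) ^ 2 := by
      have := mul_le_mul_of_nonneg_left hsq (show (0 : ℝ) ≤ k by linarith)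
      nlinarith [sq_nonneg (h (m + d + k))]
    exact le_of_pow_le_pow_left₀ two_ne_zero (by positivity) this
  have hcube : (k : ℝ) ^ 2 * h (m + k) ^ 3 ≤ ((k : ℝ) + d) ^ 2 * h (m + d + k) ^ 3 := by
    have := mul_le_mul hsq hlin (by positivity) (by positivity)
    nlinarith
  -- damping persistence
  have hΓ := damping_prod_ge hmono hL hb hlo hdom hh hf hL0 hg hgF (m + k + 1) d
  have hΓ' : (k : ℝ) / ((k : ℝ) + d) ≤ ∏ t ∈ Ico (m + k + 1) (m + k + 1 + d), g t := by
    refine le_trans ?_ hΓ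
    push_cast
    rw [div_le_div_iff₀ (by positivity) (by positivity)]
    nlinarith
  have hP0 : 0 ≤ ∏ t ∈ Ico (m + k + 1) (m + k + 1 + d), g t := prod_nonneg fun t _ => (hg t).1.le
  have hLk := hL k
  -- assemble: (k+d)³ c' Γ ≥ (k+d)³ c' · k∕(k+d) = k (k+d)² c' ≥ k · k² c
  calc (k : ℝ) ^ 3 * (L k * h (m + k) ^ 3 / 2) = (k : ℝ) * (L k / 2) * ((k : ℝ) ^ 2 * h (m + k) ^ 3) := by ring
    _ ≤ (k : ℝ) * (L k / 2) * (((k : ℝ) + d) ^ 2 * h (m + d + k) ^ 3) := mul_le_mul_of_nonneg_left hcube (by positivity)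
    _ = ((k : ℝ) + d) ^ 3 * (L k * h (m + d + k) ^ 3 / 2) * ((k : ℝ) / ((k : ℝ) + d)) := by field_simp
    _ ≤ ((k : ℝ) + d) ^ 3 * (L k * h (m + d + k) ^ 3 / 2) * ∏ t ∈ Ico (m + k + 1) (m + k + 1 + d), g t :=
        mul_le_mul_of_nonneg_left hΓ' (by positivity)

/-- The old read in window form: `Σ_{l<K} KL k m l·v(m+1+l) = Σ_{l<k} c_k(m)·(Π_{t∈[m+1+l, m+k+1)} g_t)·v(m+1+l)` (`0 < k < K`). [folklore] -/
theorem old_read_eq {KL : ℕ → ℕ → ℕ → ℝ}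
    (hKL : ∀ k n l, KL k n l = if 0 < k ∧ k < K ∧ l < k then L k * h (n + k) ^ 3 / 2 * ∏ t ∈ Ico (n + 1 + l) (n + k + 1), g t else 0)
    {k : ℕ} (hk : 0 < k) (hkK : k < K) (m : ℕ) (v : ℕ → ℝ) :
    ∑ l ∈ range K, KL k m l * v (m + 1 + l)
      = ∑ l ∈ range k, L k * h (m + k) ^ 3 / 2 * (∏ t ∈ Ico (m + 1 + l) (m + k + 1), g t) * v (m + 1 + l) := by
  rw [← sum_range_add_sum_Ico _ hkK.le]
  have h0 : ∑ l ∈ Ico k K, KL k m l * v (m + 1 + l) = 0 :=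
    sum_eq_zero fun l hl => by rw [hKL, if_neg (by have := (mem_Ico.mp hl).1; omega), zero_mul]
  rw [h0, add_zero]
  exact sum_congr rfl fun l hl => by rw [hKL, if_pos ⟨hk, hkK, mem_range.mp hl⟩]

/-- **THE OLD READ IS A SLOWLY VARYING WINDOW AVERAGE.**  Along every flow, for the self-consistent damping class and an age `k` (`0 < k < K`): if
`0 ≤ ε_q ≤ e_q` beyond the pin `m` (`e ≥ 0` non-increasing), then for `1 ≤ d ≤ k`
`Σ_l KL k m l·ε_{m+1+l} − Σ_l KL k (m+d) l·ε_{m+d+1+l} ≤ 4d·c_k(m)·e_m` — `d` entering targets cost `≤ d·c_k(m)·e_m`, and on the common targets the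
coefficient drops by at most `c_k(m)·(1 − (k∕(k+d))³) ≤ 3d·c_k(m)∕(k+d)` (`old_coeff_persist`). [folklore] -/
theorem old_read_variation (hmono : ∀ u v : ℕ → ℝ, SeqBox γ u → SeqBox γ v → (∀ j, u j ≤ v j) → B u ≤ B v) (hL : ∀ k, 0 ≤ L k) (hb : 0 < b)
    (hlo : ∀ u, SeqBox γ u → b ≤ B u) (hdom : ∀ u, SeqBox γ u → ∑ k ∈ range K, L k * u k ≤ B u) (hh : SeqBox γ h) (hf : MemFlow B gIR h)
    (hL0 : L 0 = 0) (hg : ∀ t, 0 < g t ∧ g t ≤ 1) (hgF : ∀ t, 1 ≤ g t * (1 + ∑ k ∈ range K, L k * h (t + k) ^ 3 / 2))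
    {KL : ℕ → ℕ → ℕ → ℝ}
    (hKL : ∀ k n l, KL k n l = if 0 < k ∧ k < K ∧ l < k then L k * h (n + k) ^ 3 / 2 * ∏ t ∈ Ico (n + 1 + l) (n + k + 1), g t else 0)
    {k : ℕ} (hk : 0 < k) (hkK : k < K) {m d : ℕ} (hd1 : 1 ≤ d) (hdk : d ≤ k) {e ε : ℕ → ℝ} (he0 : ∀ m, 0 ≤ e m)
    (hea : ∀ m, e (m + 1) ≤ e m) (IH : ∀ q, m < q → 0 ≤ ε q ∧ ε q ≤ e q) :
    ∑ l ∈ range K, KL k m l * ε (m + 1 + l) - ∑ l ∈ range K, KL k (m + d) l * ε (m + d + 1 + l)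
      ≤ 4 * d * (L k * h (m + k) ^ 3 / 2) * e m := by
  have hpos : ∀ n, 0 < h n := fun n => (hh n).1
  have hea' : ∀ p q, p ≤ q → e q ≤ e p := by
    intro p q hpq
    induction q, hpq using Nat.le_induction with
    | base => exact le_rfl
    | succ q _ ih => exact (hea q).trans ih
  have hP1 : ∀ a c : ℕ, ∏ t ∈ Ico a c, g t ≤ 1 := fun a c => prod_le_one (fun t _ => (hg t).1.le) fun t _ => (hg t).2
  have hP0 : ∀ a c : ℕ, 0 ≤ ∏ t ∈ Ico a c, g t := fun a c => prod_nonneg fun t _ => (hg t).1.le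
  -- the two reads in window form; split the first window at d and re-index its far part
  rw [old_read_eq hKL hk hkK m ε, old_read_eq hKL hk hkK (m + d) ε, ← sum_range_add_sum_Ico _ hdk, sum_Ico_eq_sum_range]
  set c : ℝ := L k * h (m + k) ^ 3 / 2 with hc
  set c' : ℝ := L k * h (m + d + k) ^ 3 / 2 with hc'
  set Γ : ℝ := ∏ t ∈ Ico (m + k + 1) (m + k + 1 + d), g t with hΓ
  have hc0 : 0 ≤ c := by have := hL k; have := hpos (m + k); positivity
  have hc'0 : 0 ≤ c' := by have := hL k; have := hpos (m + d + k); positivity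
  have hkr : (0 : ℝ) < k := by exact_mod_cast hk
  have hdr : (1 : ℝ) ≤ d := by exact_mod_cast hd1
  have hdk' : (d : ℝ) ≤ k := by exact_mod_cast hdk
  -- the second read dominates its first k − d targets
  have hsub : ∑ l ∈ range (k - d), c' * (∏ t ∈ Ico (m + d + 1 + l) (m + d + k + 1), g t) * ε (m + d + 1 + l)
      ≤ ∑ l ∈ range k, c' * (∏ t ∈ Ico (m + d + 1 + l) (m + d + k + 1), g t) * ε (m + d + 1 + l) :=
    sum_le_sum_of_subset_of_nonneg (range_mono (Nat.sub_le k d)) fun l _ _ =>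
      mul_nonneg (mul_nonneg hc'0 (hP0 _ _)) (IH (m + d + 1 + l) (by omega)).1
  -- on the common targets the damping product factors through Γ
  have hfac : ∀ l ∈ range (k - d), (∏ t ∈ Ico (m + d + 1 + l) (m + d + k + 1), g t)
      = (∏ t ∈ Ico (m + 1 + (d + l)) (m + k + 1), g t) * Γ := by
    intro l hl
    have hl' := mem_range.mp hl
    rw [hΓ, show m + d + 1 + l = m + 1 + (d + l) by ring, show m + d + k + 1 = m + k + 1 + d by ring]
    exact (prod_Ico_consecutive _ (by omega) (by omega)).symm
  -- bound A: the d entering targets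
  have hA : ∑ l ∈ range d, c * (∏ t ∈ Ico (m + 1 + l) (m + k + 1), g t) * ε (m + 1 + l) ≤ (d : ℝ) * (c * e m) := by
    calc ∑ l ∈ range d, c * (∏ t ∈ Ico (m + 1 + l) (m + k + 1), g t) * ε (m + 1 + l) ≤ ∑ l ∈ range d, c * e m := by
          refine sum_le_sum fun l _ => ?_
          have h1 := (IH (m + 1 + l) (by omega)).2.trans (hea' m (m + 1 + l) (by omega))
          have h2 := (IH (m + 1 + l) (by omega)).1
          calc c * (∏ t ∈ Ico (m + 1 + l) (m + k + 1), g t) * ε (m + 1 + l) ≤ c * 1 * ε (m + 1 + l) :=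
                mul_le_mul_of_nonneg_right (mul_le_mul_of_nonneg_left (hP1 _ _) hc0) h2
            _ ≤ c * e m := by rw [mul_one]; exact mul_le_mul_of_nonneg_left h1 hc0
      _ = (d : ℝ) * (c * e m) := by rw [sum_const, card_range, nsmul_eq_mul]
  -- bound B: the coefficient drop on the common targets
  have hpers := old_coeff_persist hmono hL hb hlo hdom hh hf hL0 hg hgF (show 1 ≤ k from hk) m d
  rw [← hc, ← hc', ← hΓ] at hpers
  have hdrop : c - c' * Γ ≤ 3 * d * c / ((k : ℝ) + d) := by
    -- c' Γ ≥ c k³∕(k+d)³ and (k+d)³ − k³ ≤ 3d(k+d)²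
    have hkd : (0 : ℝ) < (k : ℝ) + d := by linarith
    set s : ℝ := (k : ℝ) + d with hs
    have hx : c * (k : ℝ) ^ 3 ≤ c' * Γ * s ^ 3 := by nlinarith [hpers]
    have hX : c * (k : ℝ) ^ 3 / s ^ 3 ≤ c' * Γ := by rw [div_le_iff₀ (by positivity)]; exact hx
    have h1 : (c - c' * Γ) * s ≤ (c - c * (k : ℝ) ^ 3 / s ^ 3) * s := mul_le_mul_of_nonneg_right (by linarith) hkd.le
    have hpoly : c * s ^ 3 - c * (k : ℝ) ^ 3 ≤ 3 * d * c * s ^ 2 := by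
      have hd0 : (0 : ℝ) ≤ d := by linarith
      rw [hs]
      nlinarith [mul_nonneg hc0 (mul_nonneg hd0 (mul_nonneg hd0 hkr.le)), mul_nonneg hc0 (pow_nonneg hd0 3)]
    have h2 : (c - c * (k : ℝ) ^ 3 / s ^ 3) * s ≤ 3 * d * c := by
      rw [show (c - c * (k : ℝ) ^ 3 / s ^ 3) * s = (c * s ^ 3 - c * (k : ℝ) ^ 3) / s ^ 2 by field_simp,
        div_le_iff₀ (by positivity)]
      exact hpoly
    rw [le_div_iff₀ hkd]
    exact h1.trans h2
  have hB : ∑ l ∈ range (k - d), c * (∏ t ∈ Ico (m + 1 + (d + l)) (m + k + 1), g t) * ε (m + 1 + (d + l))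
      - ∑ l ∈ range (k - d), c' * (∏ t ∈ Ico (m + d + 1 + l) (m + d + k + 1), g t) * ε (m + d + 1 + l)
      ≤ ((k : ℝ) - d) * (3 * d * c / ((k : ℝ) + d) * e m) := by
    rw [← sum_sub_distrib]
    calc ∑ l ∈ range (k - d), (c * (∏ t ∈ Ico (m + 1 + (d + l)) (m + k + 1), g t) * ε (m + 1 + (d + l))
            - c' * (∏ t ∈ Ico (m + d + 1 + l) (m + d + k + 1), g t) * ε (m + d + 1 + l))
        ≤ ∑ l ∈ range (k - d), 3 * d * c / ((k : ℝ) + d) * e m := by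
          refine sum_le_sum fun l hl => ?_
          rw [hfac l hl, show m + d + 1 + l = m + 1 + (d + l) by ring]
          have hQ0 := hP0 (m + 1 + (d + l)) (m + k + 1)
          have hQ1 := hP1 (m + 1 + (d + l)) (m + k + 1)
          have hε0 := (IH (m + 1 + (d + l)) (by omega)).1
          have hεe := (IH (m + 1 + (d + l)) (by omega)).2.trans (hea' m (m + 1 + (d + l)) (by omega))
          have e1 : c * (∏ t ∈ Ico (m + 1 + (d + l)) (m + k + 1), g t) * ε (m + 1 + (d + l))
              - c' * ((∏ t ∈ Ico (m + 1 + (d + l)) (m + k + 1), g t) * Γ) * ε (m + 1 + (d + l))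
              = (c - c' * Γ) * ((∏ t ∈ Ico (m + 1 + (d + l)) (m + k + 1), g t) * ε (m + 1 + (d + l))) := by ring
          rw [e1]
          have h3 : 0 ≤ 3 * d * c / ((k : ℝ) + d) := by positivity
          calc (c - c' * Γ) * ((∏ t ∈ Ico (m + 1 + (d + l)) (m + k + 1), g t) * ε (m + 1 + (d + l)))
              ≤ 3 * d * c / ((k : ℝ) + d) * ((∏ t ∈ Ico (m + 1 + (d + l)) (m + k + 1), g t) * ε (m + 1 + (d + l))) :=
                mul_le_mul_of_nonneg_right hdrop (mul_nonneg hQ0 hε0)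
            _ ≤ 3 * d * c / ((k : ℝ) + d) * e m := by
                refine mul_le_mul_of_nonneg_left ?_ h3
                calc (∏ t ∈ Ico (m + 1 + (d + l)) (m + k + 1), g t) * ε (m + 1 + (d + l)) ≤ 1 * ε (m + 1 + (d + l)) :=
                      mul_le_mul_of_nonneg_right hQ1 hε0
                  _ ≤ e m := by rw [one_mul]; exact hεe
      _ = ((k : ℝ) - d) * (3 * d * c / ((k : ℝ) + d) * e m) := by
          rw [sum_const, card_range, nsmul_eq_mul, Nat.cast_sub hdk]
  -- assemble
  have hkd : (0 : ℝ) < (k : ℝ) + d := by linarith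
  have hfin : ((k : ℝ) - d) * (3 * d * c / ((k : ℝ) + d) * e m) ≤ 3 * d * (c * e m) := by
    have hem := he0 m
    have hq : ((k : ℝ) - d) / ((k : ℝ) + d) ≤ 1 := by rw [div_le_one hkd]; linarith
    have e1 : ((k : ℝ) - d) * (3 * d * c / ((k : ℝ) + d) * e m) = ((k : ℝ) - d) / ((k : ℝ) + d) * (3 * d * (c * e m)) := by
      field_simp
    rw [e1]
    have h3 : 0 ≤ 3 * d * (c * e m) := by positivity
    nlinarith
  linarith [hA, hB, hsub, hfin]

end Summit.QuantumFields.BalabanUV.Beta.EriceRemainderEnclosureHistoryAutonomyComparisonAgeCompositionTwoAgesOldRead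

end
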